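import Summits.CriticalPhenomena.CardyFormulaZ2.Theorems.CardySusyWardParafermionFamiliesToSLESixCornerFormStructure
import Summits.CriticalPhenomena.CardyFormulaZ2.Theorems.CardyComplexConeParafermionToSLESixFamiliesDiamondExactPair

/-!
# The exact face potential of the corner flow (helper `facePotential_exists` of `stub_traceIdentification`)

Helper file for the crux `CardySusyWard.ParafermionFamiliesToSLESix` (stmt-CriticalPhenomena-10814), line
`exact-potential-schwarz-christoffel`, first and purely discrete sub-lemma of the XL stub
`stub_traceIdentification`: EXISTENCE OF THE EXACT FACE POTENTIAL `H_δ = (H•, H∘)` of the corner flow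
`J(v, f) = F(v, f) · τ(v, f)` of the `q = 1`, spin-`1/3` corner observable `F = cornerObs E δ` (tree vocabulary,
`Theorems/CardyComplexConeDefs.lean`), `τ(v, f) = (medialPoint 1 (cornerTarget v f) - medialPoint 1 (cornerSource v f)) · √2`
the unit direction of the dart `(v, f)` (the skeleton's `dir v f`, written out; at the coded corner `(v, faceAt v k)`
it is `√2 · (-1 + i)/2 · iᵏ`, `dart_dir_faceAt`).

**Theorem** (`facePotential_exists`, registered helper). *For a `ℤ²`-admissible discretisation `E` of a Dobrushin
(Jordan) domain `D` (`E.Ω = D.carrier`) and a reading mesh `δ > 0` there are `Hv Hf : Site 2 → ℂ` with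
`Hv v - Hf f = cornerObs E δ v f · τ(v, f)` at every corner `(v, f)` of an inner face `f` of `E` whose vertex `v`
lies off both discrete arcs* (convention `H•(v) - H∘(f) = J(v, f)`, the skeleton's).

It is the instance `F = cornerObs E δ`, `P = {inner faces}`, `S = zdArcA ∪ zdArcB` of a purely combinatorial
statement (`exists_facePotential_of_halfCR`): *a function `F` on corners obeying Duminil-Copin's half
Cauchy–Riemann vertex relation `F(NW) - F(SE) = i (F(NE) - F(SW))` (`HalfCRRelationAt i`, clockwise table
`medialCornersAt` of the barrier file `FKParafermionicHalfCauchyRiemann.lean`) at every lattice edge with both faces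
in a finite HOLE-FREE face set `P` and both endpoints off a set `S` of sites each of which corners a face outside
`P`, has a stream function of the flow `F · τ` exact at all corners `(v, f)`, `f ∈ P`, `v ∉ S`.* Indeed, with the
dart directions inserted the vertex relation at the edge `{u, u + e_k}` is EXACTLY the closedness of the corner
form `β(v, k) = F(v, faceAt v k) · τ` around the elementary 4-cycle `u – faceAt u k – (u + e_k) – faceAt u (k + 3)`
of the vertex–face incidence graph (`flow_closedAt`; the four directions are `τ, iτ, -τ, -iτ`); the form is then
EXTENDED across the sites of `S` by the increments dictated by closedness (`exists_cornerExtension`,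
`cornerExtension_closedAt` — the device of `exists_isExactPair` of the sister crux `ParafermionToSLESixFamilies`,
imported from `CardyComplexConeParafermionToSLESixFamiliesDiamondExactPair.lean` together with the complexified
discrete Poincaré lemma `exists_complexPotential_of_holeFree` = the tree's `exists_potential_of_holeFree`, Smirnov
2010 Lemma 3.6, for real and imaginary parts), which makes it closed around EVERY interior edge of `P`, so that the
Poincaré lemma integrates it. For the instance: the inner faces of the discretisation of a
Jordan domain are finite (`finite_hasAllSides`) and hole-free (`holeFree_innerFaces`, Jordan curve theorem), arc
sites are boundary sites and corner a non-inner face (`S5.exists_not_isInnerFace_of_mem_zdBoundary`), and the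
vertex relation off the arcs is clause (a) of the landed `stub_cornerFormStructure` (`CornerForm.halfCR_offArcs`,
from `halfCRVertexRelation_of_dobrushinDomain`, Duminil-Copin 2012 Prop. 4).

WHY ONLY OFF THE ARCS. A potential exact at ALL corners of inner faces would need closedness around every lattice
edge both of whose faces are inner, including the edges with an endpoint on the wired arc `A` (at a site of a
straight run of `A` the edge pointing into the domain has both faces inner), and the vertex relation at such
edges is not in the tree (`IsInteriorMV` asks both endpoints off the arcs); at the sites of the dual-wired arc `B`
the observable vanishes (`CornerForm.cornerObs_eq_zero_of_mem_zdArcB`) but exactness there would again be a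
boundary relation. So the potential is certified exactly where the line reads it: at the corners of inner faces
with vertex off `zdArcA ∪ zdArcB` (in particular at every free-arc-adjacent site of the touch law), its values at
arc sites being unconstrained. The general statement also yields the potential on any finite hole-free set of
inner faces all of whose interior edges have both endpoints off the arcs (take `S = ∅`).
(buildfix 2026-08-20: comment-only re-land to re-enqueue the module build after its blocking imports were repaired; no declaration changed.)
-/

noncomputable section

namespace Summit.CriticalPhenomena.CardyFormulaZ2.Theorems.ParafermionFamiliesToSLESix.FacePotential

open Complex
open Literature.Probability.LatticeModels
open Literature.Probability.RandomPlanarGeometry (DobrushinDomain)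
open Literature.Barriers.CriticalPhenomena (HalfCRRelationAt medialCornersAt)
open Summit.CriticalPhenomena.CardyFormulaZ2.Cruxes.EdgePrecompact.QkzStripBoundaryArm (cornerObs)
open Summit.CriticalPhenomena.CardyFormulaZ2.Theorems.ParafermionFamiliesToSLESix.StripAnchored
open Summit.CriticalPhenomena.CardyFormulaZ2.Cruxes.ParafermionToSLESixFamilies.PotentialDarbouxPicardDiamond
  (exists_complexPotential_of_holeFree exists_cornerExtension cornerExtension_closedAt)

/-! ## Directions of the darts at coded corners -/

/-- **The dart directions at coded corners.** The unit direction
`τ(v, f) = (medialPoint 1 (cornerTarget v f) - medialPoint 1 (cornerSource v f)) · √2` of the dart `(v, faceAt v k)`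
(from the midpoint of the `k`-th edge at `v` to the midpoint of the `(k+1)`-st, `cornerSource_faceAt`,
`cornerTarget_faceAt`) is `√2 · (-1 + i)/2 · iᵏ`: north-west, south-west, south-east, north-east for `k = 0, 1, 2, 3`. -/
theorem dart_dir_faceAt (v : Site 2) (k : Fin 4) :
    (medialPoint 1 (cornerTarget v (faceAt v k)) - medialPoint 1 (cornerSource v (faceAt v k))) * (Real.sqrt 2 : ℂ) =
      (Real.sqrt 2 : ℂ) * ((-1 + I) / 2) * I ^ (k : ℕ) := by
  rw [cornerTarget_faceAt, cornerSource_faceAt, medialPoint_mk, medialPoint_mk]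
  fin_cases k <;> apply Complex.ext <;> simp [meshPoint, Site.toComplex, cornerUnit, pow_succ] <;> ring

/-! ## From the half-CR vertex relation to closedness of the flow form -/

section Flow

variable {F : Site 2 → Site 2 → ℂ} {β : Site 2 × Fin 4 → ℂ}

/-- **The vertex relation is the closedness of the flow.** If `β(v, k) = F(v, faceAt v k) · τ(v, faceAt v k)` and
`F` obeys the relation `F(u, f) - F(u + e_k, f') = i (F(u + e_k, f) - F(u, f'))` at the edge `{u, u + e_k}` with
faces `f = faceAt u k`, `f' = faceAt u (k + 3)` (Duminil-Copin's `F(NW) - F(SE) = i (F(NE) - F(SW))` in coded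
form), then `β` is closed around that edge: `β(u, k) + β(u + e_k, k + 2) = β(u + e_k, k + 1) + β(u, k + 3)` (the
directions at the four corners are `τ, -τ, iτ, -iτ`, `τ = τ(u, f)`). -/
theorem flow_closedAt
    (hβ : ∀ (v : Site 2) (k : Fin 4), β (v, k) = F v (faceAt v k) *
      ((medialPoint 1 (cornerTarget v (faceAt v k)) - medialPoint 1 (cornerSource v (faceAt v k))) * (Real.sqrt 2 : ℂ)))
    {u : Site 2} {k : Fin 4} {f f' : Site 2} (hf : faceAt u k = f) (hf' : faceAt u (k + 3) = f')
    (hrel : F u f - F (u + cornerUnit k) f' = I * (F (u + cornerUnit k) f - F u f')) :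
    β (u, k) + β (u + cornerUnit k, k + 2) = β (u + cornerUnit k, k + 1) + β (u, k + 3) := by
  have hβ' : ∀ (v : Site 2) (k : Fin 4), β (v, k) = F v (faceAt v k) * ((Real.sqrt 2 : ℂ) * ((-1 + I) / 2) * I ^ (k : ℕ)) :=
    fun v k => by rw [hβ, dart_dir_faceAt]
  -- the powers `i^{k+1}, i^{k+2}, i^{k+3}` with indices in `Fin 4` (`i⁴ = 1`; `I_pow_fin_succ` of the tree)
  have hI2 : I ^ ((k + 2 : Fin 4) : ℕ) = -I ^ (k : ℕ) := by
    rw [← fin4_add_one_add_one, I_pow_fin_succ, I_pow_fin_succ, mul_assoc, I_mul_I, mul_neg_one]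
  have hI3 : I ^ ((k + 3 : Fin 4) : ℕ) = -(I ^ (k : ℕ) * I) := by
    rw [← fin4_add_two_add_one, I_pow_fin_succ, hI2, neg_mul]
  rw [hβ', hβ', hβ', hβ', faceAt_add_unit_add_two, faceAt_add_unit_succ, hf, hf', I_pow_fin_succ, hI2, hI3]
  linear_combination ((Real.sqrt 2 : ℂ) * ((-1 + I) / 2) * I ^ (k : ℕ)) * hrel

/-- The half-CR relation at the horizontal edge `{x, x + e₀}` (clockwise table: `NW, NE, SE, SW =
(x, x), (x + e₀, x), (x + e₀, x - e₁), (x, x - e₁)`) is the coded relation at `(x, 0)`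
(`f = faceAt x 0 = x`, `f' = faceAt x 3 = x - e₁`). -/
theorem rel_zero_of_halfCR {x : Site 2} (h : HalfCRRelationAt I (fun c : Site 2 × Site 2 => F c.1 c.2) (x, 0)) :
    F x x - F (x + cornerUnit 0) (x - Pi.single 1 1) = I * (F (x + cornerUnit 0) x - F x (x - Pi.single 1 1)) := h

/-- The half-CR relation at the vertical edge `{x, x + e₁}` (clockwise table: `NW, NE, SE, SW =
(x + e₁, x - e₀), (x + e₁, x), (x, x), (x, x - e₀)`), multiplied by `i`, is the coded relation at `(x, 1)`
(`f = faceAt x 1 = x - e₀`, `f' = faceAt x 0 = x`). -/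
theorem rel_one_of_halfCR {x : Site 2} (h : HalfCRRelationAt I (fun c : Site 2 × Site 2 => F c.1 c.2) (x, 1)) :
    F x (x - Pi.single 0 1) - F (x + cornerUnit 1) x = I * (F (x + cornerUnit 1) (x - Pi.single 0 1) - F x x) := by
  have h' : F (x + Pi.single 1 1) (x - Pi.single 0 1) - F x x =
      I * (F (x + Pi.single 1 1) x - F x (x - Pi.single 0 1)) := h
  rw [show cornerUnit 1 = (Pi.single 1 1 : Site 2) from rfl]
  linear_combination (-I) * h' + (F x (x - Pi.single 0 1) - F (x + Pi.single 1 1) x) * I_sq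

end Flow

/-! ## The stream function of a half-CR solution on a hole-free face set -/

/-- **Stream functions of half-CR solutions.** Let `P` be a finite hole-free set of faces, `S` a set of sites each
of which corners a face outside `P`, and `F` a function on corners obeying the half-CR vertex relation with
coefficient `i` (`HalfCRRelationAt`, clockwise table) at every horizontal edge `{x, x + e₀}` and every vertical edge
`{x, x + e₁}` with both endpoints off `S` and both faces (`x`, `x - e₁`, resp. `x - e₀`, `x`) in `P`. Then the flow
`F · τ` has a potential pair exact at every corner of a face of `P` with vertex off `S`:
`Hv v - Hf f = F v f · τ(v, f)`. -/
theorem exists_facePotential_of_halfCR (F : Site 2 → Site 2 → ℂ) {P : Set (Site 2)} (hPfin : P.Finite)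
    (hP : HoleFree P) (S : Set (Site 2)) (hS : ∀ v ∈ S, ∃ j : Fin 4, faceAt v j ∉ P)
    (hH : ∀ x : Site 2, x ∉ S → x + Pi.single 0 1 ∉ S → x ∈ P → x - Pi.single 1 1 ∈ P →
      HalfCRRelationAt I (fun c : Site 2 × Site 2 => F c.1 c.2) (x, 0))
    (hV : ∀ x : Site 2, x ∉ S → x + Pi.single 1 1 ∉ S → x - Pi.single 0 1 ∈ P → x ∈ P →
      HalfCRRelationAt I (fun c : Site 2 × Site 2 => F c.1 c.2) (x, 1)) :
    ∃ Hv Hf : Site 2 → ℂ, ∀ v f : Site 2, IsCorner v f → f ∈ P → v ∉ S →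
      Hv v - Hf f = F v f * ((medialPoint 1 (cornerTarget v f) - medialPoint 1 (cornerSource v f)) * (Real.sqrt 2 : ℂ)) := by
  classical
  have faceAt_zero : ∀ x : Site 2, faceAt x 0 = x := fun x => by simp [faceAt, cornerOff]
  have faceAt_one : ∀ x : Site 2, faceAt x 1 = x - Pi.single 0 1 := fun x => by simp [faceAt, cornerOff]
  have faceAt_three : ∀ x : Site 2, faceAt x 3 = x - Pi.single 1 1 := fun x => by simp [faceAt, cornerOff]
  have fin4_cases : ∀ j : Fin 4, j = 0 ∨ j = 1 ∨ j = 2 ∨ j = 3 := by decide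
  -- the flow form on coded corners and its closedness off `S`
  set β : Site 2 × Fin 4 → ℂ := fun q => F q.1 (faceAt q.1 q.2) *
    ((medialPoint 1 (cornerTarget q.1 (faceAt q.1 q.2)) - medialPoint 1 (cornerSource q.1 (faceAt q.1 q.2))) *
      (Real.sqrt 2 : ℂ)) with hβdef
  have hβ : ∀ (v : Site 2) (k : Fin 4), β (v, k) = F v (faceAt v k) *
      ((medialPoint 1 (cornerTarget v (faceAt v k)) - medialPoint 1 (cornerSource v (faceAt v k))) * (Real.sqrt 2 : ℂ)) :=
    fun v k => rfl
  have closed0 : ∀ x : Site 2, x ∉ S → x + cornerUnit 0 ∉ S → faceAt x 0 ∈ P → faceAt x 3 ∈ P →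
      β (x, 0) + β (x + cornerUnit 0, 0 + 2) = β (x + cornerUnit 0, 0 + 1) + β (x, 0 + 3) := by
    intro x hx hx' h0 h3
    rw [faceAt_zero] at h0
    rw [faceAt_three] at h3
    exact flow_closedAt hβ (faceAt_zero x) (faceAt_three x) (rel_zero_of_halfCR (hH x hx hx' h0 h3))
  have closed1 : ∀ x : Site 2, x ∉ S → x + cornerUnit 1 ∉ S → faceAt x 1 ∈ P → faceAt x 0 ∈ P →
      β (x, 1) + β (x + cornerUnit 1, 1 + 2) = β (x + cornerUnit 1, 1 + 1) + β (x, 1 + 3) := by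
    intro x hx hx' h1 h0
    rw [faceAt_one] at h1
    rw [faceAt_zero] at h0
    exact flow_closedAt hβ (faceAt_one x) (faceAt_zero x) (rel_one_of_halfCR (hV x hx hx' h1 h0))
  have hclosedβ : ∀ (u : Site 2) (k : Fin 4), u ∉ S → u + cornerUnit k ∉ S → faceAt u k ∈ P →
      faceAt u (k + 3) ∈ P → β (u, k) + β (u + cornerUnit k, k + 2) = β (u + cornerUnit k, k + 1) + β (u, k + 3) := by
    intro u k hu hu' hk hk'
    rcases fin4_cases k with rfl | rfl | rfl | rfl
    · exact closed0 u hu hu' hk hk'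
    · exact closed1 u hu hu' hk hk'
    · -- the edge `{u, u - e₀}` is the horizontal edge at `u - e₀`
      have hback : u + cornerUnit 2 + cornerUnit 0 = u := DiscreteDobrushin.add_cornerUnit_add_cornerUnit_add_two u 2
      have e1 : faceAt (u + cornerUnit 2) 0 = faceAt u (2 + 3) := faceAt_add_unit_add_two u 2
      have e2 : faceAt (u + cornerUnit 2) 3 = faceAt u 2 := faceAt_add_unit_succ u 2
      have h := closed0 (u + cornerUnit 2) hu' (by rw [hback]; exact hu) (by rw [e1]; exact hk') (by rw [e2]; exact hk)
      rw [hback] at h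
      have e3 : ((0 : Fin 4) + 2 : Fin 4) = 2 := rfl
      have e4 : ((0 : Fin 4) + 1 : Fin 4) = 2 + 3 := rfl
      have e5 : ((0 : Fin 4) + 3 : Fin 4) = 2 + 1 := rfl
      have e6 : ((2 : Fin 4) + 2 : Fin 4) = 0 := rfl
      rw [e3, e4, e5] at h
      rw [e6]
      linear_combination h
    · -- the edge `{u, u - e₁}` is the vertical edge at `u - e₁`
      have hback : u + cornerUnit 3 + cornerUnit 1 = u := DiscreteDobrushin.add_cornerUnit_add_cornerUnit_add_two u 3
      have e1 : faceAt (u + cornerUnit 3) 1 = faceAt u (3 + 3) := faceAt_add_unit_add_two u 3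
      have e2 : faceAt (u + cornerUnit 3) 0 = faceAt u 3 := faceAt_add_unit_succ u 3
      have h := closed1 (u + cornerUnit 3) hu' (by rw [hback]; exact hu) (by rw [e1]; exact hk') (by rw [e2]; exact hk)
      rw [hback] at h
      have e3 : ((1 : Fin 4) + 2 : Fin 4) = 3 := rfl
      have e4 : ((1 : Fin 4) + 1 : Fin 4) = 3 + 3 := rfl
      have e5 : ((1 : Fin 4) + 3 : Fin 4) = 3 + 1 := rfl
      have e6 : ((3 : Fin 4) + 2 : Fin 4) = 1 := rfl
      rw [e3, e4, e5] at h
      rw [e6]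
      linear_combination h
  -- extension across `S`, closed on all of `P`
  set Δ : Site 2 → Fin 4 → ℂ := fun v c =>
    if v + cornerUnit c ∈ S then 0 else β (v + cornerUnit c, c + 1) - β (v + cornerUnit c, c + 2) with hΔ
  obtain ⟨ω, hωβ, hωS⟩ := exists_cornerExtension S P β Δ hS
  have hclosed : ∀ (u : Site 2) (k : Fin 4), faceAt u k ∈ P → faceAt u (k + 3) ∈ P →
      ω (u, k) + ω (u + cornerUnit k, k + 2) = ω (u + cornerUnit k, k + 1) + ω (u, k + 3) :=
    fun u k h₁ h₂ => cornerExtension_closedAt (fun v c h => by simp only [hΔ]; rw [if_pos h])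
      (fun v c h => by simp only [hΔ]; rw [if_neg h]) hωβ hωS hclosedβ h₁ h₂
  -- integrate
  have hcoe : (↑hPfin.toFinset : Set (Site 2)) = P := hPfin.coe_toFinset
  have hHF : HoleFree (↑hPfin.toFinset : Set (Site 2)) := by rw [hcoe]; exact hP
  obtain ⟨Hw, Hb, hpot⟩ := exists_complexPotential_of_holeFree ω _ hHF fun u k hu₁ hu₂ => by
    rw [hcoe] at hu₁ hu₂
    exact hclosed u k hu₁ hu₂
  refine ⟨fun v => -Hw v, fun f => -Hb f, fun v f hc hf hv => ?_⟩
  obtain ⟨k, rfl⟩ := exists_faceAt_of_isCorner hc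
  have hq : ((v, k) : Site 2 × Fin 4) ∈ faceSetCorners (↑hPfin.toFinset : Set (Site 2)) := by
    rw [mem_faceSetCorners, hcoe]; exact hf
  have key := hpot (v, k) hq
  rw [hωβ (v, k) hv] at key
  simp only [cFace] at key
  rw [hβ] at key
  linear_combination key

/-! ## The registered helper -/

/-- **Existence of the exact face potential of the corner flow** (helper `facePotential_exists` of
`stub_traceIdentification`, line `exact-potential-schwarz-christoffel`). For a `ℤ²`-admissible discretisation `E`
of a Dobrushin (Jordan) domain `D` and a reading mesh `δ > 0` there are a vertex potential `Hv` and a face potential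
`Hf` with `Hv v - Hf f = cornerObs E δ v f · τ(v, f)`,
`τ(v, f) = (medialPoint 1 (cornerTarget v f) - medialPoint 1 (cornerSource v f)) · √2` the unit direction of the
dart (the skeleton's `dir v f`), at every corner `(v, f)` of an inner face `f` with `v` off both discrete arcs
(`exists_facePotential_of_halfCR` with `P` the finite hole-free set of inner faces — `finite_hasAllSides`,
`holeFree_innerFaces` — `S = zdArcA ∪ zdArcB`, whose sites corner non-inner faces, and the vertex relation
`CornerForm.halfCR_offArcs`, Duminil-Copin 2012 Prop. 4). -/
theorem facePotential_exists : ∀ (D : DobrushinDomain) (E : DiscreteDobrushin), E.Ω = D.carrier → E.IsZdAdmissible → ∀ δ : ℝ, 0 < δ → ∃ Hv Hf : Site 2 → ℂ, ∀ v f : Site 2, IsCorner v f → E.IsInnerFace f → v ∉ E.zdArcA → v ∉ E.zdArcB → Hv v - Hf f = cornerObs E δ v f * ((medialPoint 1 (cornerTarget v f) - medialPoint 1 (cornerSource v f)) * (Real.sqrt 2 : ℂ)) := by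
  intro D E hΩ hE δ hδ
  set P : Set (Site 2) := {f | E.IsInnerFace f} with hP
  set S : Set (Site 2) := E.zdArcA ∪ E.zdArcB with hS
  have hPfin : P.Finite := finite_hasAllSides hE.isBounded hE.delta_pos
  have hHF : HoleFree P := holeFree_innerFaces D.toJordanDomain hΩ hE.delta_pos
  have hSb : S ⊆ E.zdBoundary := Set.union_subset E.zdArcA_subset_zdBoundary E.zdArcB_subset_zdBoundary
  have hj : ∀ v ∈ S, ∃ j : Fin 4, faceAt v j ∉ P := by
    intro v hv
    obtain ⟨g, hvg, hg⟩ := S5.exists_not_isInnerFace_of_mem_zdBoundary (hSb hv)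
    obtain ⟨j, rfl⟩ := exists_faceAt_of_isCorner hvg
    exact ⟨j, hg⟩
  have hH : ∀ x : Site 2, x ∉ S → x + Pi.single 0 1 ∉ S → x ∈ P → x - Pi.single 1 1 ∈ P →
      HalfCRRelationAt I (fun c : Site 2 × Site 2 => cornerObs E δ c.1 c.2) (x, 0) := by
    intro x hx hx' h0 _
    have h0' : E.IsInnerFace (faceAt x 0) := by rw [show faceAt x 0 = x from by simp [faceAt, cornerOff]]; exact h0
    have he : s(x, x + Pi.single 0 1) ∈ (discreteDomainGraph E.Ω E.δ).edgeSet :=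
      DiscreteDobrushin.adj_of_isInnerFace_faceAt (k := 0) h0' (Or.inl rfl)
    exact CornerForm.halfCR_offArcs D E hΩ hE x 0 he (fun h => hx (Or.inl h)) (fun h => hx (Or.inr h))
      (fun h => hx' (Or.inl h)) (fun h => hx' (Or.inr h)) δ hδ
  have hV : ∀ x : Site 2, x ∉ S → x + Pi.single 1 1 ∉ S → x - Pi.single 0 1 ∈ P → x ∈ P →
      HalfCRRelationAt I (fun c : Site 2 × Site 2 => cornerObs E δ c.1 c.2) (x, 1) := by
    intro x hx hx' _ h0
    have h0' : E.IsInnerFace (faceAt x (1 + 3)) := by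
      rw [show (1 : Fin 4) + 3 = 0 from rfl, show faceAt x 0 = x from by simp [faceAt, cornerOff]]; exact h0
    have he : s(x, x + Pi.single 1 1) ∈ (discreteDomainGraph E.Ω E.δ).edgeSet :=
      DiscreteDobrushin.adj_of_isInnerFace_faceAt (k := 1) h0' (Or.inr rfl)
    exact CornerForm.halfCR_offArcs D E hΩ hE x 1 he (fun h => hx (Or.inl h)) (fun h => hx (Or.inr h))
      (fun h => hx' (Or.inl h)) (fun h => hx' (Or.inr h)) δ hδ
  obtain ⟨Hv, Hf, h⟩ := exists_facePotential_of_halfCR (fun v f => cornerObs E δ v f) hPfin hHF S hj hH hV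
  exact ⟨Hv, Hf, fun v f hc hf hvA hvB => h v f hc hf (fun hv => hv.elim hvA hvB)⟩

end Summit.CriticalPhenomena.CardyFormulaZ2.Theorems.ParafermionFamiliesToSLESix.FacePotential

end
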